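import Summits.HubbardSuperconductivity.HubbardSuperconductivity.Theorems.KLProgrammeKLRegimeScaleZeroCovarianceStripDecay

/-!
# Route `KLProgramme`, crux K3 — engine-flow child (stmt-HubbardSuperconductivity-20437), stub (C) at `n = 0`, located item #22a «(C)-SCALE0-PT2»,
# (2e) FAR SITES: the exponential door for the cutoff-free shell, FINITE-`L` form (sum over images)

`…ScaleZeroCovarianceStripDecay` bounds the infinite-lattice kernel of the cutoff-free shell `|ω| ≥ Λ`:
`‖𝓕g_ω(n)‖ ≤ (2/|ω|)·e^{−κ‖n‖∞}`, `κ = arsinh(|ω|/4)`.  Here the engine's own object — the finite-torus sample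
`L⁻²Σ_{k⃗} χ_{k⃗}(z̄)Ψ(ω, e₀(k⃗))` — is bounded through the images identity `torusFourierInv_uvSpatialSample_eq_tsum_images` and
`PeriodizedDecay.sub_le_norm_translate` (`‖z + Ln‖ ≥ L‖n‖ − ‖z‖`): for a CENTRED site (`2‖z‖∞ ≤ L`) and `e^{−κL/2} ≤ 1/2`,

  **`‖L⁻²Σ_{k⃗} χ_{k⃗}(z̄)Ψ(ω, e₀(k⃗))‖ ≤ 25·(2/|ω|)·e^{−κ‖z‖∞}`**  (`norm_torusFourierInv_uvSpatialSample_le_exp`),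

the images being summed by the product majorant `e^{−κL(‖n‖∞−1)} ≤ ρ^{(|n₀|−1)₊}ρ^{(|n₁|−1)₊}`, `ρ = e^{−κL/2}`, `Σ_{ℤ²} = (1 + 2/(1−ρ))² ≤ 25`.
[cite: GlimmJaffeQP1987, Prop. 7.3.1]; [cite: BenfattoGiulianiMastropietro2006, §2.2 footnote 1]; [cite: TrefethenWeideman2014, §4 Thm. 4.2].
-/

noncomputable section

namespace Summit.HubbardSuperconductivity.HubbardSuperconductivity.Theorems.KLRegimeSplit

set_option linter.dupNamespace false -- summit = problem name (single-conjunct summit), D-0017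

open Literature.MathematicalPhysics.QuantumLattice Literature.Analysis.FunctionSpaces Literature.Probability.LatticeModels
open Summit.HubbardSuperconductivity.HubbardSuperconductivity.Theorems.DispersionFlow
open Complex UnitAddTorus Real

variable {L : ℕ} [NeZero L]

/-! ## §D Lattice bookkeeping on `ℤ²` with the sup norm -/

omit [NeZero L] in
/-- `‖m‖∞ = max(|m₀|, |m₁|)` on `ℤ²` (as reals). [folklore] -/
theorem norm_site_two_eq_max (m : Site 2) : ‖m‖ = max |(m 0 : ℝ)| |(m 1 : ℝ)| := by
  apply le_antisymm
  · refine (pi_norm_le_iff_of_nonneg (by positivity)).2 ?_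
    rw [Fin.forall_fin_two]
    refine ⟨?_, ?_⟩
    · rw [Int.norm_eq_abs]; exact le_max_left _ _
    · rw [Int.norm_eq_abs]; exact le_max_right _ _
  · refine max_le ?_ ?_
    · have h := norm_le_pi_norm m 0
      rwa [Int.norm_eq_abs] at h
    · have h := norm_le_pi_norm m 1
      rwa [Int.norm_eq_abs] at h

omit [NeZero L] in
/-- `‖m‖∞ = max(|m₀|, |m₁|)` with natural absolute values. [folklore] -/
theorem norm_site_two_eq_max_natAbs (m : Site 2) : ‖m‖ = max (((m 0).natAbs : ℕ) : ℝ) (((m 1).natAbs : ℕ) : ℝ) := by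
  rw [norm_site_two_eq_max, Nat.cast_natAbs, Nat.cast_natAbs, Int.cast_abs, Int.cast_abs]

omit [NeZero L] in
/-- **The image exponents**: for `m ≠ 0`, `(|m₀|−1)₊ + (|m₁|−1)₊ + 2 ≤ 2‖m‖∞`. [folklore] -/
theorem natAbs_sub_one_add_le (m : Site 2) (hm : m ≠ 0) :
    ((((m 0).natAbs - 1 : ℕ)) : ℝ) + ((((m 1).natAbs - 1 : ℕ)) : ℝ) + 2 ≤ 2 * ‖m‖ := by
  have key : ((m 0).natAbs - 1) + ((m 1).natAbs - 1) + 2 ≤ 2 * max (m 0).natAbs (m 1).natAbs := by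
    by_cases hA : (m 0).natAbs = 0
    · by_cases hB : (m 1).natAbs = 0
      · exfalso
        apply hm
        funext i
        fin_cases i
        · exact Int.natAbs_eq_zero.1 hA
        · exact Int.natAbs_eq_zero.1 hB
      · omega
    · omega
  rw [norm_site_two_eq_max_natAbs, ← Nat.cast_max]
  exact_mod_cast key

omit [NeZero L] in
/-- `Σ_{k ∈ ℤ} ρ^{(|k|−1)₊} = 1 + 2/(1−ρ)` for `0 ≤ ρ < 1`. [folklore] -/
theorem hasSum_int_pow_natAbs_sub_one {ρ : ℝ} (h0 : 0 ≤ ρ) (h1 : ρ < 1) :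
    HasSum (fun k : ℤ => ρ ^ (k.natAbs - 1)) (1 + 2 * (1 - ρ)⁻¹) := by
  have hgeo : HasSum (fun n : ℕ => ρ ^ n) (1 - ρ)⁻¹ := hasSum_geometric_of_lt_one h0 h1
  have hshift : HasSum (fun n : ℕ => ρ ^ (n + 1 - 1)) (1 - ρ)⁻¹ := by
    simp only [Nat.add_sub_cancel]
    exact hgeo
  have hnat : HasSum (fun n : ℕ => ρ ^ (n - 1)) ((1 - ρ)⁻¹ + 1) := by
    have h := (hasSum_nat_add_iff (f := fun n : ℕ => ρ ^ (n - 1)) 1).1 hshift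
    rw [Finset.sum_range_one, Nat.zero_sub, pow_zero] at h
    exact h
  have hpos : HasSum (fun n : ℕ => (fun k : ℤ => ρ ^ (k.natAbs - 1)) (n : ℤ)) ((1 - ρ)⁻¹ + 1) := by
    have : (fun n : ℕ => (fun k : ℤ => ρ ^ (k.natAbs - 1)) (n : ℤ)) = fun n : ℕ => ρ ^ (n - 1) := by
      funext n
      simp only [Int.natAbs_natCast]
    rw [this]
    exact hnat
  have hneg : HasSum (fun n : ℕ => (fun k : ℤ => ρ ^ (k.natAbs - 1)) (-(n + 1 : ℤ))) (1 - ρ)⁻¹ := by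
    have : (fun n : ℕ => (fun k : ℤ => ρ ^ (k.natAbs - 1)) (-(n + 1 : ℤ))) = fun n : ℕ => ρ ^ n := by
      funext n
      simp only [Int.natAbs_neg]
      rw [show ((n : ℤ) + 1) = ((n + 1 : ℕ) : ℤ) by push_cast; rfl, Int.natAbs_natCast, Nat.add_sub_cancel]
    rw [this]
    exact hgeo
  have h := HasSum.of_nat_of_neg_add_one (f := fun k : ℤ => ρ ^ (k.natAbs - 1)) hpos hneg
  convert h using 1
  ring

omit [NeZero L] in
/-- `Σ_{m ∈ ℤ²} ρ^{(|m₀|−1)₊}·ρ^{(|m₁|−1)₊} = (1 + 2/(1−ρ))²`. [folklore] -/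
theorem tsum_site_two_prod_weight {ρ : ℝ} (h0 : 0 ≤ ρ) (h1 : ρ < 1) :
    HasSum (fun m : Site 2 => ρ ^ ((m 0).natAbs - 1) * ρ ^ ((m 1).natAbs - 1)) ((1 + 2 * (1 - ρ)⁻¹) ^ 2) := by
  have h1d := hasSum_int_pow_natAbs_sub_one h0 h1
  have hn : Summable fun k : ℤ => ‖ρ ^ (k.natAbs - 1)‖ := by
    simpa only [Real.norm_eq_abs] using h1d.summable.abs
  have hprod : HasSum (fun p : ℤ × ℤ => ρ ^ (p.1.natAbs - 1) * ρ ^ (p.2.natAbs - 1)) ((1 + 2 * (1 - ρ)⁻¹) ^ 2) := by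
    have hs : Summable (fun p : ℤ × ℤ => ρ ^ (p.1.natAbs - 1) * ρ ^ (p.2.natAbs - 1)) :=
      summable_mul_of_summable_norm (f := fun k : ℤ => ρ ^ (k.natAbs - 1)) (g := fun k : ℤ => ρ ^ (k.natAbs - 1)) hn hn
    have heq : ∑' p : ℤ × ℤ, ρ ^ (p.1.natAbs - 1) * ρ ^ (p.2.natAbs - 1) = (1 + 2 * (1 - ρ)⁻¹) ^ 2 := by
      rw [← tsum_mul_tsum_of_summable_norm (f := fun k : ℤ => ρ ^ (k.natAbs - 1)) (g := fun k : ℤ => ρ ^ (k.natAbs - 1)) hn hn,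
        h1d.tsum_eq, sq]
    rw [← heq]
    exact hs.hasSum
  exact (Equiv.hasSum_iff (finTwoArrowEquiv ℤ)
    (f := fun p : ℤ × ℤ => ρ ^ (p.1.natAbs - 1) * ρ ^ (p.2.natAbs - 1))).2 hprod

/-! ## §E The finite-`L` sample of the cutoff-free shell: sum over images -/

/-- **Exponential off-site decay of the scale-`0` covariance's spatial factor on the cutoff-free shell, finite `L`, per frequency**:
for `0 < Λ ≤ |ω|`, every CENTRED site `z` (`2‖z‖∞ ≤ L`) and `e^{−κL/2} ≤ 1/2` (`κ = arsinh(|ω|/4)`),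
`‖L⁻²Σ_{k⃗} χ_{k⃗}(z̄)Ψ(1, Λ; e₀(k⃗), ω)‖ ≤ 25·(2/|ω|)·e^{−κ‖z‖∞}` — the finite-volume kernel decays like the infinite-volume one with an
`L`-independent constant (images: `torusFourierInv_uvSpatialSample_eq_tsum_images`; door: `norm_mFourierCoeff_uvSpatialSymbol_le_exp`).
[cite: GlimmJaffeQP1987, Prop. 7.3.1]; [cite: BenfattoGiulianiMastropietro2006, §2.2 footnote 1] -/
theorem norm_torusFourierInv_uvSpatialSample_le_exp {Λ : ℝ} (hΛ : 0 < Λ) (μ : ℝ) {om : ℝ} (hom : Λ ≤ |om|)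
    {z : Site 2} (hz : 2 * ‖z‖ ≤ L) (hρ : Real.exp (-(Real.arsinh (|om| / 4) * L / 2)) ≤ 1 / 2) :
    ‖torusFourierInv (fun kv : TorusSite 2 L =>
          (fun y : Momentum => uvSymbolFn 1 Λ (frameLevel μ 0 ((2 * π) • y)) om) (WithLp.toLp 2 fun i => ((kv i).val : ℝ) / L))
          (Torus.proj L z)‖ ≤ 25 * (2 / |om|) * Real.exp (-(Real.arsinh (|om| / 4) * ‖z‖)) := by
  have hom0' : 0 < |om| := hΛ.trans_le hom
  have hom0 : om ≠ 0 := abs_pos.1 hom0'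
  set κ : ℝ := Real.arsinh (|om| / 4) with hκ
  have hκ0 : 0 < κ := Real.arsinh_pos_iff.2 (by positivity)
  set ρ : ℝ := Real.exp (-(κ * L / 2)) with hρdef
  have hρ0 : 0 ≤ ρ := (Real.exp_pos _).le
  have hρ1 : ρ < 1 := hρ.trans_lt (by norm_num)
  have hinvρ : (1 - ρ)⁻¹ ≤ 2 := by
    rw [inv_le_comm₀ (by linarith) (by norm_num)]
    linarith
  rw [torusFourierInv_uvSpatialSample_eq_tsum_images 1 μ 0 hom0 z]
  set c : Site 2 → ℂ := fun m => mFourierCoeff (Torus.descend (fun y : Momentum => uvSymbolFn 1 Λ (frameLevel μ 0 ((2 * π) • y)) om)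
    (uvSpatialSymbol_isLatticePeriodic 1 Λ μ 0 om)) (-(z + (L : ℤ) • m)) with hc
  show ‖∑' m : Site 2, c m‖ ≤ _
  -- injectivity of the image map, summability of the norms
  have hLz : (L : ℤ) ≠ 0 := by exact_mod_cast (NeZero.ne L)
  have hinj : Function.Injective (fun m : Site 2 => -(z + (L : ℤ) • m)) := by
    intro m m' h
    have h' : z + (L : ℤ) • m = z + (L : ℤ) • m' := neg_injective h
    have h'' : (L : ℤ) • m = (L : ℤ) • m' := add_left_cancel h'
    funext i
    have hi := congrFun h'' i
    simp only [Pi.smul_apply, smul_eq_mul] at hi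
    exact mul_left_cancel₀ hLz hi
  have hsum : Summable fun m : Site 2 => ‖c m‖ :=
    (summable_norm_mFourierCoeff_descend (uvSpatialSymbol_isLatticePeriodic 1 Λ μ 0 om)
      (uvSpatialSymbol_contDiff 1 μ 0 hom0)).comp_injective hinj
  -- termwise bound through the door
  have hterm : ∀ m : Site 2,
      ‖c m‖ ≤ 2 / |om| * Real.exp (-(κ * ‖z‖)) * (ρ ^ ((m 0).natAbs - 1) * ρ ^ ((m 1).natAbs - 1)) := by
    intro m
    have hdoor := norm_mFourierCoeff_uvSpatialSymbol_le_exp hΛ μ hom (-(z + (L : ℤ) • m))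
    have hmax : max |(((-(z + (L : ℤ) • m)) 0 : ℤ) : ℝ)| |(((-(z + (L : ℤ) • m)) 1 : ℤ) : ℝ)| = ‖z + (L : ℤ) • m‖ := by
      rw [norm_site_two_eq_max]
      simp only [Pi.neg_apply, Int.cast_neg, abs_neg]
    rw [hmax] at hdoor
    refine hdoor.trans ?_
    rw [mul_assoc]
    refine mul_le_mul_of_nonneg_left ?_ (by positivity)
    -- the geometry of the images
    have hgeom : ‖z‖ + (L : ℝ) / 2 * ((((m 0).natAbs - 1 : ℕ) : ℝ) + (((m 1).natAbs - 1 : ℕ) : ℝ)) ≤ ‖z + (L : ℤ) • m‖ := by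
      by_cases hm : m = 0
      · subst hm
        simp
      · have h1 := natAbs_sub_one_add_le m hm
        have h2 := Literature.Probability.LatticeModels.sub_le_norm_translate L z m
        have hL0 : (0 : ℝ) ≤ L := by positivity
        nlinarith [mul_le_mul_of_nonneg_left h1 hL0]
    have e1 : ρ ^ ((m 0).natAbs - 1) * ρ ^ ((m 1).natAbs - 1) =
        Real.exp (-(κ * L / 2) * ((((m 0).natAbs - 1 : ℕ) : ℝ) + (((m 1).natAbs - 1 : ℕ) : ℝ))) := by
      rw [hρdef, ← Real.exp_nat_mul, ← Real.exp_nat_mul, ← Real.exp_add]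
      ring_nf
    rw [e1, ← Real.exp_add, Real.exp_le_exp]
    have := mul_le_mul_of_nonneg_left hgeom hκ0.le
    nlinarith
  -- sum the majorant
  have hmaj : HasSum (fun m : Site 2 => 2 / |om| * Real.exp (-(κ * ‖z‖)) * (ρ ^ ((m 0).natAbs - 1) * ρ ^ ((m 1).natAbs - 1)))
      (2 / |om| * Real.exp (-(κ * ‖z‖)) * (1 + 2 * (1 - ρ)⁻¹) ^ 2) :=
    (tsum_site_two_prod_weight hρ0 hρ1).mul_left _
  calc ‖∑' m : Site 2, c m‖ ≤ ∑' m : Site 2, ‖c m‖ := norm_tsum_le_tsum_norm hsum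
    _ ≤ ∑' m : Site 2, 2 / |om| * Real.exp (-(κ * ‖z‖)) * (ρ ^ ((m 0).natAbs - 1) * ρ ^ ((m 1).natAbs - 1)) :=
        hsum.tsum_le_tsum hterm hmaj.summable
    _ = 2 / |om| * Real.exp (-(κ * ‖z‖)) * (1 + 2 * (1 - ρ)⁻¹) ^ 2 := hmaj.tsum_eq
    _ ≤ 2 / |om| * Real.exp (-(κ * ‖z‖)) * (1 + 2 * 2) ^ 2 := by
        gcongr
    _ = 25 * (2 / |om|) * Real.exp (-(κ * ‖z‖)) := by ring


/-! ## §F (append) The θ-sharpened finite-`L` door (`0 < θ < 1`): rate `arsinh(θ|ω|/2)`, height `25/((1−θ)|ω|)` -/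

/-- **θ-sharpened finite-`L` exponential door** (`0 < Λ ≤ |ω|`, `0 < θ < 1`, `2‖z‖∞ ≤ L`, `e^{−κ_θ L/2} ≤ 1/2`, `κ_θ = arsinh(θ|ω|/2)`):
`‖L⁻²Σ_{k⃗} χ_{k⃗}(z̄)Ψ(1, Λ; e₀(k⃗), ω)‖ ≤ 25·e^{−κ_θ‖z‖∞}/((1−θ)|ω|)` — e.g. `θ = 0.9` at `|ω| = klE0`: rate `e^{−‖z‖∞/71.1…}`, height `25·320`.
[cite: GlimmJaffeQP1987, Prop. 7.3.1]; [cite: TrefethenWeideman2014, §4 Thm. 4.2] -/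
theorem norm_torusFourierInv_uvSpatialSample_le_exp_of_lt_one {Λ : ℝ} (hΛ : 0 < Λ) (μ : ℝ) {om : ℝ} (hom : Λ ≤ |om|)
    {θ : ℝ} (hθ0 : 0 < θ) (hθ1 : θ < 1)
    {z : Site 2} (hz : 2 * ‖z‖ ≤ L) (hρ : Real.exp (-(Real.arsinh (θ * |om| / 2) * L / 2)) ≤ 1 / 2) :
    ‖torusFourierInv (fun kv : TorusSite 2 L =>
          (fun y : Momentum => uvSymbolFn 1 Λ (frameLevel μ 0 ((2 * π) • y)) om) (WithLp.toLp 2 fun i => ((kv i).val : ℝ) / L))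
          (Torus.proj L z)‖ ≤ 25 * (1 / ((1 - θ) * |om|)) * Real.exp (-(Real.arsinh (θ * |om| / 2) * ‖z‖)) := by
  have hom0' : 0 < |om| := hΛ.trans_le hom
  have hom0 : om ≠ 0 := abs_pos.1 hom0'
  set κ : ℝ := Real.arsinh (θ * |om| / 2) with hκ
  have hκ0 : 0 < κ := Real.arsinh_pos_iff.2 (by positivity)
  set ρ : ℝ := Real.exp (-(κ * L / 2)) with hρdef
  have hρ0 : 0 ≤ ρ := (Real.exp_pos _).le
  have hρ1 : ρ < 1 := hρ.trans_lt (by norm_num)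
  have hinvρ : (1 - ρ)⁻¹ ≤ 2 := by
    rw [inv_le_comm₀ (by linarith) (by norm_num)]
    linarith
  rw [torusFourierInv_uvSpatialSample_eq_tsum_images 1 μ 0 hom0 z]
  set c : Site 2 → ℂ := fun m => mFourierCoeff (Torus.descend (fun y : Momentum => uvSymbolFn 1 Λ (frameLevel μ 0 ((2 * π) • y)) om)
    (uvSpatialSymbol_isLatticePeriodic 1 Λ μ 0 om)) (-(z + (L : ℤ) • m)) with hc
  show ‖∑' m : Site 2, c m‖ ≤ _
  -- injectivity of the image map, summability of the norms
  have hLz : (L : ℤ) ≠ 0 := by exact_mod_cast (NeZero.ne L)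
  have hinj : Function.Injective (fun m : Site 2 => -(z + (L : ℤ) • m)) := by
    intro m m' h
    have h' : z + (L : ℤ) • m = z + (L : ℤ) • m' := neg_injective h
    have h'' : (L : ℤ) • m = (L : ℤ) • m' := add_left_cancel h'
    funext i
    have hi := congrFun h'' i
    simp only [Pi.smul_apply, smul_eq_mul] at hi
    exact mul_left_cancel₀ hLz hi
  have hsum : Summable fun m : Site 2 => ‖c m‖ :=
    (summable_norm_mFourierCoeff_descend (uvSpatialSymbol_isLatticePeriodic 1 Λ μ 0 om)
      (uvSpatialSymbol_contDiff 1 μ 0 hom0)).comp_injective hinj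
  -- termwise bound through the door
  have hterm : ∀ m : Site 2,
      ‖c m‖ ≤ 1 / ((1 - θ) * |om|) * Real.exp (-(κ * ‖z‖)) * (ρ ^ ((m 0).natAbs - 1) * ρ ^ ((m 1).natAbs - 1)) := by
    intro m
    have hdoor := norm_mFourierCoeff_uvSpatialSymbol_le_exp_of_lt_one hΛ μ hom hθ0 hθ1 (-(z + (L : ℤ) • m))
    have hmax : max |(((-(z + (L : ℤ) • m)) 0 : ℤ) : ℝ)| |(((-(z + (L : ℤ) • m)) 1 : ℤ) : ℝ)| = ‖z + (L : ℤ) • m‖ := by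
      rw [norm_site_two_eq_max]
      simp only [Pi.neg_apply, Int.cast_neg, abs_neg]
    rw [hmax] at hdoor
    refine hdoor.trans ?_
    rw [mul_assoc]
    have h1θ : 0 < 1 - θ := by linarith
    refine mul_le_mul_of_nonneg_left ?_ (by positivity)
    -- the geometry of the images
    have hgeom : ‖z‖ + (L : ℝ) / 2 * ((((m 0).natAbs - 1 : ℕ) : ℝ) + (((m 1).natAbs - 1 : ℕ) : ℝ)) ≤ ‖z + (L : ℤ) • m‖ := by
      by_cases hm : m = 0
      · subst hm
        simp
      · have h1 := natAbs_sub_one_add_le m hm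
        have h2 := Literature.Probability.LatticeModels.sub_le_norm_translate L z m
        have hL0 : (0 : ℝ) ≤ L := by positivity
        nlinarith [mul_le_mul_of_nonneg_left h1 hL0]
    have e1 : ρ ^ ((m 0).natAbs - 1) * ρ ^ ((m 1).natAbs - 1) =
        Real.exp (-(κ * L / 2) * ((((m 0).natAbs - 1 : ℕ) : ℝ) + (((m 1).natAbs - 1 : ℕ) : ℝ))) := by
      rw [hρdef, ← Real.exp_nat_mul, ← Real.exp_nat_mul, ← Real.exp_add]
      ring_nf
    rw [e1, ← Real.exp_add, Real.exp_le_exp]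
    have := mul_le_mul_of_nonneg_left hgeom hκ0.le
    nlinarith
  -- sum the majorant
  have h1θ : 0 < 1 - θ := by linarith
  have hmaj : HasSum (fun m : Site 2 => 1 / ((1 - θ) * |om|) * Real.exp (-(κ * ‖z‖)) * (ρ ^ ((m 0).natAbs - 1) * ρ ^ ((m 1).natAbs - 1)))
      (1 / ((1 - θ) * |om|) * Real.exp (-(κ * ‖z‖)) * (1 + 2 * (1 - ρ)⁻¹) ^ 2) :=
    (tsum_site_two_prod_weight hρ0 hρ1).mul_left _
  calc ‖∑' m : Site 2, c m‖ ≤ ∑' m : Site 2, ‖c m‖ := norm_tsum_le_tsum_norm hsum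
    _ ≤ ∑' m : Site 2, 1 / ((1 - θ) * |om|) * Real.exp (-(κ * ‖z‖)) * (ρ ^ ((m 0).natAbs - 1) * ρ ^ ((m 1).natAbs - 1)) :=
        hsum.tsum_le_tsum hterm hmaj.summable
    _ = 1 / ((1 - θ) * |om|) * Real.exp (-(κ * ‖z‖)) * (1 + 2 * (1 - ρ)⁻¹) ^ 2 := hmaj.tsum_eq
    _ ≤ 1 / ((1 - θ) * |om|) * Real.exp (-(κ * ‖z‖)) * (1 + 2 * 2) ^ 2 := by
        gcongr
    _ = 25 * (1 / ((1 - θ) * |om|)) * Real.exp (-(κ * ‖z‖)) := by ring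



/-! ## §G (append) Frequency-uniform form on the shell `|ω| ≥ Λ`: one rate `arsinh(θΛ/2)`, height `25/((1−θ)·max(|ω|, Λ/2))` -/

/-- **Frequency-uniform finite-`L` door on the cutoff-free shell**: for `0 < Λ ≤ |ω|`, `0 < θ < 1`, `2‖z‖∞ ≤ L` and `e^{−κ_Λ L/2} ≤ 1/2` with the
ω-INDEPENDENT rate `κ_Λ = arsinh(θΛ/2)`: `‖L⁻²Σ_{k⃗} χ_{k⃗}(z̄)Ψ(1, Λ; e₀(k⃗), ω)‖ ≤ (25/(1−θ))·(1/max(|ω|, Λ/2))·e^{−κ_Λ‖z‖∞}` — the shape that sums over the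
Matsubara window with `sum_matsubaraIdx_one_div_max_sq_le` (`Σ_i 1/max(|ω_i|, Λ/2)² ≤ β·2/Λ`), uniformly in `β`.
[cite: GlimmJaffeQP1987, Prop. 7.3.1]; [cite: BenfattoGiulianiMastropietro2006, §2.2 footnote 1] -/
theorem norm_torusFourierInv_uvSpatialSample_le_exp_uniform {Λ : ℝ} (hΛ : 0 < Λ) (μ : ℝ) {om : ℝ} (hom : Λ ≤ |om|)
    {θ : ℝ} (hθ0 : 0 < θ) (hθ1 : θ < 1)
    {z : Site 2} (hz : 2 * ‖z‖ ≤ L) (hρ : Real.exp (-(Real.arsinh (θ * Λ / 2) * L / 2)) ≤ 1 / 2) :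
    ‖torusFourierInv (fun kv : TorusSite 2 L =>
          (fun y : Momentum => uvSymbolFn 1 Λ (frameLevel μ 0 ((2 * π) • y)) om) (WithLp.toLp 2 fun i => ((kv i).val : ℝ) / L))
          (Torus.proj L z)‖ ≤ 25 / (1 - θ) * (1 / max |om| (Λ / 2)) * Real.exp (-(Real.arsinh (θ * Λ / 2) * ‖z‖)) := by
  have hom0' : 0 < |om| := hΛ.trans_le hom
  have h1θ : 0 < 1 - θ := by linarith
  have hκ : Real.arsinh (θ * Λ / 2) ≤ Real.arsinh (θ * |om| / 2) :=
    Real.arsinh_le_arsinh.2 (by nlinarith)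
  have hL0 : (0 : ℝ) ≤ L := by positivity
  have hρ' : Real.exp (-(Real.arsinh (θ * |om| / 2) * L / 2)) ≤ 1 / 2 := by
    refine le_trans (Real.exp_le_exp.2 ?_) hρ
    nlinarith
  have h := norm_torusFourierInv_uvSpatialSample_le_exp_of_lt_one (L := L) hΛ μ hom hθ0 hθ1 hz hρ'
  refine h.trans ?_
  have hmax : max |om| (Λ / 2) = |om| := max_eq_left (by linarith)
  rw [hmax]
  have hexp : Real.exp (-(Real.arsinh (θ * |om| / 2) * ‖z‖)) ≤ Real.exp (-(Real.arsinh (θ * Λ / 2) * ‖z‖)) :=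
    Real.exp_le_exp.2 (by nlinarith [norm_nonneg z])
  calc 25 * (1 / ((1 - θ) * |om|)) * Real.exp (-(Real.arsinh (θ * |om| / 2) * ‖z‖))
      ≤ 25 * (1 / ((1 - θ) * |om|)) * Real.exp (-(Real.arsinh (θ * Λ / 2) * ‖z‖)) :=
        mul_le_mul_of_nonneg_left hexp (by positivity)
    _ = 25 / (1 - θ) * (1 / |om|) * Real.exp (-(Real.arsinh (θ * Λ / 2) * ‖z‖)) := by
        field_simp

end Summit.HubbardSuperconductivity.HubbardSuperconductivity.Theorems.KLRegimeSplit

end
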